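import Mathlib
import Summits.NavierStokesRegularity.NavierStokesRegularity.Theorems.EulerZoomLiouvillePowerGaugeEulerLiouvilleNeedleClockLocal
import HarnessLib

/-!
# LAGRANGIAN CONFINEMENT: almost every backward similarity orbit of a member LINGERS at every large scale
# (crux `EulerZoomLiouville.PowerGaugeEulerLiouville` = stmt-NavierStokesRegularity-19832, portrait of THE ONE STATEMENT `stub_selfSimilarC2Needle`)

Route `EulerZoomLiouville` (NavierStokesRegularity), crux E, LEAD seat ns-typeII-p2 g13 (own brick #7, the POSITIVE form of the waiting-time law).  The exit half of
ns-ezl-w2 g3's threshold (ROUND-38 (T_pow) ∘ (K″)) is an UNCONDITIONAL statement about every exactly self-similar `C²` member of the class: for EVERY ball `B(x₀, r)`,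
every large `R` and every cut-off copy, the labels of the ball whose backward similarity orbit leaves `B̄_{2R}` before time `c′R^{2+ρ}` have volume `≤ A/R`
(`c′ = β/(12γ)`, `A = 8√C/(3γκδ²)` from the strong thin fast exits).  Summing over dyadic scales (Borel–Cantelli):

* `NeedleRace.volume_exit_le_of_strongThinExits` — profile level: (K″) ⇒ the exit bound `A/R` for every ball `B(x₀, r) ⊆ B̄_R`, `R ≥ 1`, every cut-off copy;
* `NeedleRace.volume_exit_le_of_selfSimilarC2` — member level (crux hypotheses verbatim, `0 < ρ ≤ ½`, exact self-similarity about the origin, `V ∈ C²`):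
  `∃ c′ > 0, ∃ A ≥ 0`, the exit bound for every ball, scale and cut-off copy;
* `NeedleRace.ae_eventually_linger_of_selfSimilarC2` — **almost every label of every ball LINGERS at every large dyadic scale**: along any scales `R_k ≥ 2^k`
  (with `B(x₀,r) ⊆ B̄_{R_k}`) and any cut-off copies `V′_k = V` on `B(0, Rbig_k) ⊋ B̄_{2R_k}`, for a.e. `y ∈ B(x₀, r)`, eventually in `k`, the backward orbit of `y` stays in
  `B̄_{2R_k}` during `[0, c′R_k^{2+ρ}]` — sub-ballistic Lagrangian confinement `‖Y(σ)‖ = O(σ^{1/(2+ρ)})` of almost every orbit, in physical variables: almost every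
  particle path of the member stays within `O((−t)^γ (log(−t))^γ)` of the singular point as `t → −∞` along the similarity clock.

Portrait line (N9) for THE ONE STATEMENT: LINGERING IS GENERIC — every residence clock (binder `HasResidenceClock`, all seven senses) asks for ONE ball violating this
almost-sure confinement quantitatively (half the ball exiting), which is why one clocked ball kills (`…NeedleClockLocal`).
WHAT THIS IS NOT: not NS, not E — a structural theorem about members (no new estimate: the waiting-time law read positively), `--supports` stmt-19832; the crux is OPEN;
NS regularity is NOT proved. [folklore; ConstantinIgnatovaVicol2026Putative §3.4.1 (3.21)–(3.22), §3.5; Borel–Cantelli]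
-/

noncomputable section

-- flat `Theorems/<Route><Decl>…` files of one crux share the namespace of the crux (tree convention: `Summit.<S>.<S>.…`)
set_option linter.dupNamespace false

open Set Filter Topology Metric Function MeasureTheory InnerProductSpace
open scoped RealInnerProductSpace NNReal ENNReal

namespace Summit.NavierStokesRegularity.NavierStokesRegularity.Theorems.PowerGaugeEulerLiouville.NeedleRace

open Literature.Analysis Literature.Analysis.FluidPDE Literature.Analysis.FunctionSpaces
open Summit.NavierStokesRegularity.NavierStokesRegularity.Theorems.PowerGaugeEulerLiouville

section Profile

variable {γ : ℝ} {U : EuclideanSpace ℝ (Fin 3) → EuclideanSpace ℝ (Fin 3)}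

/-- **THE EXIT BOUND FOR EVERY BALL (profile level).**  `U ∈ C²` divergence-free, `γ > 0`; (K″) thin-exit data of size `C R⁴ e^{−βR^e}` for every `R ≥ 1`;
`0 ≤ c′`, `6γc′ < β`.  Then for every ball `B(x₀, r) ⊆ B̄_R` (`R ≥ 1`) and every `C²` globally Lipschitz cut-off copy `V = U` on `B(0, Rbig) ⊋ B̄_{2R}`, the labels of
`B(x₀, r)` leaving `B̄_{2R}` before backward time `c′R^e` have volume `≤ (8√C/(3γκ(β/2 − 3γc′)²))/R`.  (The exit half of `false_of_powerClockAt_of_strongThinExits`.)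
[folklore; ConstantinIgnatovaVicol2026Putative §3.5] -/
theorem volume_exit_le_of_strongThinExits (hdivU : VectorCalculus.IsDivFree U)
    (hγ : 0 < γ) {κ : ℝ} (hκ : 0 < κ) {e β C : ℝ} (he : 1 ≤ e) (hC : 0 ≤ C)
    (hthinS : ∀ R : ℝ, 1 ≤ R →
      ∃ (G : Set ℝ) (N : Set (EuclideanSpace ℝ (Fin 3))),
        MeasurableSet G ∧ G ⊆ Icc (R ^ 2) ((2 * R) ^ 2) ∧ κ * R ^ 2 ≤ (volume G).toReal ∧
        MeasurableSet N ∧ N ⊆ closedBall (0 : EuclideanSpace ℝ (Fin 3)) (2 * R) ∧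
        (∀ z : EuclideanSpace ℝ (Fin 3), ‖z‖ ^ 2 ∈ G → ⟪U z, z⟫ + γ * ‖z‖ ^ 2 < 0 → z ∈ N) ∧
        volume N * ∫⁻ z in N, ENNReal.ofReal (‖U z‖ ^ 2) ≤
          ENNReal.ofReal (C * R ^ (4 : ℝ) * Real.exp (-(β * R ^ e))))
    {c' : ℝ} (hc' : 0 ≤ c') (hβc : 6 * γ * c' < β)
    (x₀ : EuclideanSpace ℝ (Fin 3)) (r : ℝ) {R : ℝ} (hR1 : 1 ≤ R) (hRx : ‖x₀‖ + r ≤ R)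
    {V : EuclideanSpace ℝ (Fin 3) → EuclideanSpace ℝ (Fin 3)} {K Rbig : ℝ} (hV2 : ContDiff ℝ 2 V)
    (hK : ∀ y, ‖fderiv ℝ V y‖ ≤ K) (hRbig : 2 * R < Rbig)
    (hVU : ∀ w ∈ ball (0 : EuclideanSpace ℝ (Fin 3)) Rbig, V w = U w) :
    (volume (ball x₀ r \ {y | ∀ σ ∈ Icc 0 (c' * R ^ e),
        ‖ODE.evolutionMap (fun _ : ℝ => selfSimilarTransport γ 0 V) 0 (-σ) y‖ ≤ 2 * R})).toReal ≤
      8 * Real.sqrt C / (3 * γ * κ * (β / 2 - 3 * γ * c') ^ 2) / R := by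
  have hδ : 0 < β / 2 - 3 * γ * c' := by linarith
  set δ : ℝ := β / 2 - 3 * γ * c' with hδdef
  set B₀ : Set (EuclideanSpace ℝ (Fin 3)) := ball x₀ r with hB₀
  have hB₀m : MeasurableSet B₀ := measurableSet_ball
  set A : ℝ := 8 * Real.sqrt C / (3 * γ * κ * δ ^ 2) with hA
  have hR0 : 0 < R := by linarith
  obtain ⟨G, N, hGm, hG, hGvol, hNm, hNsub, hLemK, hNJ⟩ := hthinS R hR1
  set S : ℝ := c' * R ^ e with hSdef
  have hS : 0 ≤ S := mul_nonneg hc' (Real.rpow_nonneg hR0.le _)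
  -- ### the cut-off field is divergence free on `B̄_{2R}`
  have hdiv : ∀ z : EuclideanSpace ℝ (Fin 3), ‖z‖ ≤ 2 * R → VectorCalculus.divergence V z = 0 := by
    intro z hz
    have hzball : z ∈ ball (0 : EuclideanSpace ℝ (Fin 3)) Rbig := mem_ball_zero_iff.2 (by linarith)
    have hev : V =ᶠ[𝓝 z] U := by
      filter_upwards [isOpen_ball.mem_nhds hzball] with w hw using hVU w hw
    unfold VectorCalculus.divergence
    rw [hev.fderiv_eq]
    exact hdivU z
  set Φ := ODE.evolutionMap (fun _ : ℝ => selfSimilarTransport γ 0 V) 0 with hΦ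
  -- ### the blob sits in `B̄_R`
  have hB₀R : B₀ ⊆ closedBall (0 : EuclideanSpace ℝ (Fin 3)) R := by
    intro y hy
    rw [hB₀, mem_ball] at hy
    rw [mem_closedBall_zero_iff]
    have h1 : ‖y‖ ≤ ‖y - x₀‖ + ‖x₀‖ := norm_le_norm_sub_add y x₀
    rw [← dist_eq_norm] at h1
    linarith
  set Stay : Set (EuclideanSpace ℝ (Fin 3)) := {y | ∀ σ ∈ Icc 0 S, ‖Φ (-σ) y‖ ≤ 2 * R} with hStay
  -- ### feeding law + bookkeeping + the power-clock arithmetic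
  have h2raw := ofReal_mul_volume_exit_le (γ := γ) (U := U) hV2 hK hγ hR0 hRbig hVU hdiv hS hB₀m hB₀R hGm hG
    hNm hNsub hLemK
  set cS : ℝ := (Real.exp (3 * γ * S) - 1) / (3 * γ) with hcS
  have hcS0 : 0 ≤ cS := by
    rw [hcS]
    apply div_nonneg _ (by positivity)
    have : 1 ≤ Real.exp (3 * γ * S) := Real.one_le_exp (by positivity)
    linarith
  set g : ℝ := (volume G).toReal / (4 * R) with hg
  have hgκ : κ * R / 4 ≤ g := by
    rw [hg, le_div_iff₀ (by positivity)]
    nlinarith [hGvol, hR0, hκ]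
  have hgpos : 0 < g := lt_of_lt_of_le (by positivity) hgκ
  have hε0 : 0 ≤ C * R ^ (4 : ℝ) * Real.exp (-(β * R ^ e)) := by positivity
  have h3 := toReal_le_of_feeding (N := N) hgpos hcS0 hε0 h2raw hNJ
  show (volume (B₀ \ Stay)).toReal ≤ A / R
  refine h3.trans ?_
  have h4 : cS * Real.sqrt (C * R ^ (4 : ℝ) * Real.exp (-(β * R ^ e))) / g ≤
      cS * Real.sqrt (C * R ^ (4 : ℝ) * Real.exp (-(β * R ^ e))) / (κ * R / 4) :=
    div_le_div_of_nonneg_left (by positivity) (by positivity) hgκ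
  refine h4.trans ?_
  have h5 : cS * Real.sqrt (C * R ^ (4 : ℝ) * Real.exp (-(β * R ^ e))) / (κ * R / 4) =
      4 / (κ * R) * cS * Real.sqrt (C * R ^ (4 : ℝ) * Real.exp (-(β * R ^ e))) := by
    field_simp
  rw [h5, hcS, hSdef]
  have h6 := exit_arith_powerClock (C := C) hγ hκ he hR1 hδ
  rw [← hδdef] at h6
  refine h6.trans (le_of_eq ?_)
  rw [hA]
  field_simp

end Profile

section Member

variable {V : EuclideanSpace ℝ (Fin 3) → EuclideanSpace ℝ (Fin 3)}

/-- **THE EXIT BOUND FOR EVERY BALL (member level).**  An exactly self-similar member of the window class (`0 < ρ ≤ ½`, crux hypotheses verbatim) with a `C²`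
profile: for some `c′ > 0` and `A ≥ 0`, for EVERY ball `B(x₀, r) ⊆ B̄_R` (`R ≥ 1`) and every cut-off copy, the labels leaving `B̄_{2R}` before backward similarity
time `c′R^{2+ρ}` have volume `≤ A/R`. [folklore; ConstantinIgnatovaVicol2026Putative §3.5] -/
theorem volume_exit_le_of_selfSimilarC2 {ρ : ℝ} (hρ : 0 < ρ) (hρ1 : ρ ≤ 1 / 2)
    {u : ℝ → EuclideanSpace ℝ (Fin 3) → EuclideanSpace ℝ (Fin 3)} {p : ℝ → EuclideanSpace ℝ (Fin 3) → ℝ}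
    {H : ℝ → EuclideanSpace ℝ (Fin 3) → EuclideanSpace ℝ (Fin 3) →L[ℝ] EuclideanSpace ℝ (Fin 3)} {c : ℝ≥0}
    (hsw : IsSuitableWeakSolutionOn (slab (EuclideanSpace ℝ (Fin 3)) (Iio 0) isOpen_Iio) 0 0 u p)
    (hH : HasWeakSpatialGradientOn (slab (EuclideanSpace ℝ (Fin 3)) (Iio 0) isOpen_Iio) u H)
    (hgauge : ∀ a : ℝ, 0 < a →
      ENNReal.ofReal (a ^ (2 * ρ)) * cknA a (0 : ℝ × EuclideanSpace ℝ (Fin 3)) u +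
          ENNReal.ofReal (a ^ ρ) * cknE a (0 : ℝ × EuclideanSpace ℝ (Fin 3)) H +
        ENNReal.ofReal (a ^ (2 * ρ)) * cknD a (0 : ℝ × EuclideanSpace ℝ (Fin 3)) p ≤ (c : ℝ≥0∞))
    {P : EuclideanSpace ℝ (Fin 3) → ℝ}
    (hu : ∀ τ : ℝ, τ < 0 → u τ = selfSimilarCollapse (1 / (2 + ρ)) 0 V τ)
    (hp : ∀ τ : ℝ, τ < 0 → p τ = selfSimilarCollapsePressure (1 / (2 + ρ)) 0 P τ)
    (hV : ContDiff ℝ 2 V) :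
    ∃ c' : ℝ, 0 < c' ∧ ∃ A : ℝ, 0 ≤ A ∧ ∀ (x₀ : EuclideanSpace ℝ (Fin 3)) (r R : ℝ), 1 ≤ R → ‖x₀‖ + r ≤ R →
      ∀ (V' : EuclideanSpace ℝ (Fin 3) → EuclideanSpace ℝ (Fin 3)) (K Rbig : ℝ), ContDiff ℝ 2 V' →
        (∀ y, ‖fderiv ℝ V' y‖ ≤ K) → 2 * R < Rbig →
        (∀ w ∈ ball (0 : EuclideanSpace ℝ (Fin 3)) Rbig, V' w = V w) →
        (volume (ball x₀ r \ {y | ∀ σ ∈ Icc 0 (c' * R ^ (2 + ρ)),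
          ‖ODE.evolutionMap (fun _ : ℝ => selfSimilarTransport (1 / (2 + ρ)) 0 V') 0 (-σ) y‖ ≤ 2 * R})).toReal ≤ A / R := by
  have hρ1' : ρ < 1 := by linarith
  have h2ρ : (0 : ℝ) < 2 + ρ := by linarith
  have hγ : (0 : ℝ) < 1 / (2 + ρ) := one_div_pos.2 h2ρ
  have h1ρ : 0 ≤ 1 - ρ := by linarith
  have hA : ∀ a : ℝ, 0 < a → ENNReal.ofReal (a ^ (2 * ρ)) *
      cknA a (0 : ℝ × EuclideanSpace ℝ (Fin 3)) u ≤ (c : ℝ≥0∞) :=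
    fun a ha => le_trans (le_trans le_self_add le_self_add) (hgauge a ha)
  -- divergence-free profile and the class budgets on closed balls (as in `thinFastExits_of_selfSimilarC2`)
  obtain ⟨hdiv, -⟩ := thinFastExits_of_selfSimilarC2 hρ hρ1 hsw hH hgauge hu hp hV
  obtain ⟨hA', hE'⟩ :=
    NeedleThinCore.selfSimilar_needle_inputs hρ hρ1' hsw hH hgauge hu hp (hV.of_le one_le_two)
  have hbA : ∀ L : ℝ, 1 ≤ L →
      ∫⁻ z in closedBall (0 : EuclideanSpace ℝ (Fin 3)) L, ‖V z‖ₑ ^ 2 ≤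
        ENNReal.ofReal ((c : ℝ) * 2 ^ (1 - 2 * ρ) * L ^ (1 - 2 * ρ)) := by
    intro L hL
    have hL0 : 0 < L := by linarith
    calc ∫⁻ z in closedBall (0 : EuclideanSpace ℝ (Fin 3)) L, ‖V z‖ₑ ^ 2
        ≤ ∫⁻ z in ball (0 : EuclideanSpace ℝ (Fin 3)) (2 * L), ‖V z‖ₑ ^ 2 :=
          lintegral_mono_set (closedBall_subset_ball (by linarith))
      _ ≤ (c : ℝ≥0∞) * ENNReal.ofReal ((2 * L) ^ (1 - 2 * ρ)) := hA' (2 * L) (by linarith)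
      _ = ENNReal.ofReal ((c : ℝ) * 2 ^ (1 - 2 * ρ) * L ^ (1 - 2 * ρ)) := by
          rw [Real.mul_rpow two_pos.le hL0.le, ← ENNReal.ofReal_coe_nnreal,
            ← ENNReal.ofReal_mul (NNReal.coe_nonneg c)]
          congr 1
          ring
  have hE0 : 0 ≤ (1 - ρ) / (2 + ρ) * (c : ℝ) := by positivity
  have hbE : ∀ L : ℝ, 1 ≤ L →
      ∫⁻ z in closedBall (0 : EuclideanSpace ℝ (Fin 3)) L, ‖fderiv ℝ V z‖ₑ ^ 2 ≤
        ENNReal.ofReal ((1 - ρ) / (2 + ρ) * (c : ℝ) * L ^ (1 - ρ)) :=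
    fun L hL => lintegral_fderiv_sq_closedBall_le hρ1' hE0 hE' hL
  -- (K″): strong thin exits
  obtain ⟨β, hβ, C, hC, hthinS⟩ :=
    NeedleFastSetMeasure.thinFastExits_strong' (hV.of_le (by norm_num)) hγ hρ.le hρ1 (by positivity) hE0 hbA hbE
  -- the clock at strength `c′ = β/(12γ)`, so that `6γc′ = β/2 < β`
  set c' : ℝ := β / (12 * (1 / (2 + ρ))) with hc'
  have hc'0 : 0 < c' := by rw [hc']; positivity
  have hβc : 6 * (1 / (2 + ρ)) * c' < β := by
    rw [hc']
    field_simp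
    nlinarith [hβ, h2ρ]
  refine ⟨c', hc'0, 8 * Real.sqrt C / (3 * (1 / (2 + ρ)) * 1 * (β / 2 - 3 * (1 / (2 + ρ)) * c') ^ 2), by positivity, ?_⟩
  intro x₀ r R hR1 hRx V' K Rbig hV2 hK hRbig hVU
  exact volume_exit_le_of_strongThinExits (γ := 1 / (2 + ρ)) (e := 2 + ρ) hdiv hγ one_pos (by linarith) hC hthinS
    hc'0.le hβc x₀ r hR1 hRx hV2 hK hRbig hVU

/-- **LAGRANGIAN CONFINEMENT: ALMOST EVERY LABEL OF EVERY BALL LINGERS AT EVERY LARGE DYADIC SCALE.**  An exactly self-similar member of the window class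
(`0 < ρ ≤ ½`, crux hypotheses verbatim) with a `C²` profile; scales `R_k ≥ 2^k` with `B(x₀, r) ⊆ B̄_{R_k}`, and `C²` globally Lipschitz cut-off copies `V′_k = V`
on `B(0, Rbig_k) ⊋ B̄_{2R_k}`.  Then for a.e. `y ∈ B(x₀, r)`, eventually in `k`, the backward similarity orbit of `y` (for `V′_k`) stays in `B̄_{2R_k}` during
`[0, c′R_k^{2+ρ}]` (Borel–Cantelli over `volume_exit_le_of_selfSimilarC2`).  Sub-ballistic confinement `‖Y(σ)‖ = O(σ^{1/(2+ρ)})` of almost every orbit.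
[folklore; ConstantinIgnatovaVicol2026Putative §3.5; Borel–Cantelli] -/
theorem ae_eventually_linger_of_selfSimilarC2 {ρ : ℝ} (hρ : 0 < ρ) (hρ1 : ρ ≤ 1 / 2)
    {u : ℝ → EuclideanSpace ℝ (Fin 3) → EuclideanSpace ℝ (Fin 3)} {p : ℝ → EuclideanSpace ℝ (Fin 3) → ℝ}
    {H : ℝ → EuclideanSpace ℝ (Fin 3) → EuclideanSpace ℝ (Fin 3) →L[ℝ] EuclideanSpace ℝ (Fin 3)} {c : ℝ≥0}
    (hsw : IsSuitableWeakSolutionOn (slab (EuclideanSpace ℝ (Fin 3)) (Iio 0) isOpen_Iio) 0 0 u p)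
    (hH : HasWeakSpatialGradientOn (slab (EuclideanSpace ℝ (Fin 3)) (Iio 0) isOpen_Iio) u H)
    (hgauge : ∀ a : ℝ, 0 < a →
      ENNReal.ofReal (a ^ (2 * ρ)) * cknA a (0 : ℝ × EuclideanSpace ℝ (Fin 3)) u +
          ENNReal.ofReal (a ^ ρ) * cknE a (0 : ℝ × EuclideanSpace ℝ (Fin 3)) H +
        ENNReal.ofReal (a ^ (2 * ρ)) * cknD a (0 : ℝ × EuclideanSpace ℝ (Fin 3)) p ≤ (c : ℝ≥0∞))
    {P : EuclideanSpace ℝ (Fin 3) → ℝ}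
    (hu : ∀ τ : ℝ, τ < 0 → u τ = selfSimilarCollapse (1 / (2 + ρ)) 0 V τ)
    (hp : ∀ τ : ℝ, τ < 0 → p τ = selfSimilarCollapsePressure (1 / (2 + ρ)) 0 P τ)
    (hV : ContDiff ℝ 2 V) :
    ∃ c' : ℝ, 0 < c' ∧ ∀ (x₀ : EuclideanSpace ℝ (Fin 3)) (r : ℝ) (Rs : ℕ → ℝ)
      (V' : ℕ → EuclideanSpace ℝ (Fin 3) → EuclideanSpace ℝ (Fin 3)) (K Rbig : ℕ → ℝ),
      (∀ k, (2 : ℝ) ^ k ≤ Rs k) → (∀ k, ‖x₀‖ + r ≤ Rs k) →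
      (∀ k, ContDiff ℝ 2 (V' k)) → (∀ k y, ‖fderiv ℝ (V' k) y‖ ≤ K k) → (∀ k, 2 * Rs k < Rbig k) →
      (∀ k, ∀ w ∈ ball (0 : EuclideanSpace ℝ (Fin 3)) (Rbig k), V' k w = V w) →
      ∀ᵐ y ∂(volume : Measure (EuclideanSpace ℝ (Fin 3))), y ∈ ball x₀ r →
        ∀ᶠ k in atTop, ∀ σ ∈ Icc 0 (c' * Rs k ^ (2 + ρ)),
          ‖ODE.evolutionMap (fun _ : ℝ => selfSimilarTransport (1 / (2 + ρ)) 0 (V' k)) 0 (-σ) y‖ ≤ 2 * Rs k := by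
  obtain ⟨c', hc', A, hA0, hexit⟩ := volume_exit_le_of_selfSimilarC2 hρ hρ1 hsw hH hgauge hu hp hV
  refine ⟨c', hc', ?_⟩
  intro x₀ r Rs V' K Rbig hRs hRx hV2 hK hRbig hVU
  set s : ℕ → Set (EuclideanSpace ℝ (Fin 3)) := fun k => ball x₀ r \ {y | ∀ σ ∈ Icc 0 (c' * Rs k ^ (2 + ρ)),
    ‖ODE.evolutionMap (fun _ : ℝ => selfSimilarTransport (1 / (2 + ρ)) 0 (V' k)) 0 (-σ) y‖ ≤ 2 * Rs k} with hs
  have h1 : ∀ k, (1 : ℝ) ≤ Rs k := fun k => le_trans (one_le_pow₀ (by norm_num : (1 : ℝ) ≤ 2)) (hRs k)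
  -- ### the exit bound at every scale, as a bound on measures
  have hsk : ∀ k, volume (s k) ≤ ENNReal.ofReal (A * (1 / 2) ^ k) := by
    intro k
    have hfin : volume (s k) ≠ ⊤ := ((measure_mono Set.sdiff_subset).trans_lt measure_ball_lt_top).ne
    have hle : (volume (s k)).toReal ≤ A / Rs k :=
      hexit x₀ r (Rs k) (h1 k) (hRx k) (V' k) (K k) (Rbig k) (hV2 k) (hK k) (hRbig k) (hVU k)
    have hle' : A / Rs k ≤ A * (1 / 2) ^ k := by
      rw [div_eq_mul_inv, one_div, inv_pow]
      exact mul_le_mul_of_nonneg_left (inv_anti₀ (by positivity) (hRs k)) hA0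
    rw [← ENNReal.ofReal_toReal hfin]
    exact ENNReal.ofReal_le_ofReal (hle.trans hle')
  -- ### Borel–Cantelli
  have hsum : (∑' k, volume (s k)) ≠ ⊤ := by
    refine ne_top_of_le_ne_top ?_ (ENNReal.tsum_le_tsum hsk)
    have hs' : Summable fun k : ℕ => A * (1 / 2 : ℝ) ^ k :=
      (summable_geometric_of_lt_one (by norm_num) (by norm_num)).mul_left A
    rw [← ENNReal.ofReal_tsum_of_nonneg (fun k => by positivity) hs']
    exact ENNReal.ofReal_ne_top
  filter_upwards [ae_eventually_notMem hsum] with y hy hyB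
  filter_upwards [hy] with k hk
  by_contra hnot
  exact hk ⟨hyB, hnot⟩

end Member

end Summit.NavierStokesRegularity.NavierStokesRegularity.Theorems.PowerGaugeEulerLiouville.NeedleRace

end
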